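import Summits.BirchSwinnertonDyer.BirchSwinnertonDyer.Theorems.EisensteinPrimesNoPseudoNullOfBridge
import Literature.NumberTheory.EllipticCurves.KellerYin2024.CharacterModulePrufer
import Literature.NumberTheory.GaloisRepresentations.ArtinRestriction
import HarnessLib

/-!
# Route `EisensteinPrimes` (rung K5), crux 2 `GoodLatticeBDPValue`, line `halves` v6, stub
# `stub_shapiroBridge` (K-Sh): THE MODEL — `θ` is unramified outside a finite `S ⊇ S_p`
# (`N_S ≤ ker θ`), and the bridge REDUCES to the pure Shapiro statement for the named model
# `(ℚ_p/ℤ_p, ρ_θ = characterRepUnramified S θ h)` (helper for stmt-BirchSwinnertonDyer-19032)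

Cell `bsd-eis`, seat `bsd-eis-k5-c2` (gen 9); HOME/k5-c2-MEMO-9.md ADDENDUM 1 (K-Sh blueprint) and
MEMO-8 §3 glue G-d. Inputs landed by k5-ty g11 (p526002, `KellerYin2024/CharacterModulePrufer.lean`):
`QpModZp.discreteTopology`, `QpModZp.continuousSMul`, `unitChar θ : Γ_K →ₜ* ℤ_pˣ`,
`isOpen_ker_unitChar_of_pow_eq_one`, `characterRepUnramified S θ h : ContinuousRep (G_{K,S}) ℤ_[p] (QpModZp p)`
with `characterRepUnramified_hscalar`; the tree's `FramedGaloisRep.eventually_isUnramifiedAt_of_isOpen_ker`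
(a representation with open kernel is unramified at all but finitely many places) and
`ramificationSubgroup_le_ker` (`RestrictedRamification.lean`).

* §1 `exists_finite_ramificationSubgroup_le_ker_unitChar` (glue G-d): for `θ : Γ_K → GL₁(𝓞)` with
  `θⁿ = 1`, `0 < n`, there is a FINITE set `S` of finite places containing every `v ∣ p` with
  `N_S ≤ ker (unitChar θ)` — so `ρ_θ := characterRepUnramified S θ h` exists; with
  `characterRepUnramified_pow_eq_one` (`ρ_θⁿ = 1`).
* §2 `shapiroBridge_of_pureShapiroBridge`: the registered `stub_shapiroBridge` (halves v6: an
  `∃`-telescope over corank-one scalar MODELS, a ring automorphism `ι` and the identification `e`)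
  FOLLOWS from the PURE statement "for every finite `S ⊇ S_p` with `N_S ≤ ker θ` and every dual
  datum `D`, there is `e : S_{𝓛_v}(K, Ind_{K̃_∞/K} ℚ_p/ℤ_p(θ)) ≃+ H¹_{nr}(K̃_∞, A_θ)` with
  `D.toDual (r • x) (e c) = D.toDual x (e (r • c))`" — model := `(QpModZp p, characterRepUnramified S θ h)`,
  `e₀ := refl`, `ι := id` (orientation settled in `…TwistDeformationShapiroCocycle`), topologies on
  `ℤ_p⟦T⟧`, `Λ₂` := discrete. The pure statement is what a K-Sh worker proves (bricks S2–S6 of the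
  blueprint); it quantifies over the (Prop-valued) topological instances so that no instance is
  declared here.
Theorems only; no named fact, no instance, no `sorry`. HONEST FRAMING: §2 is a reduction between
two displayed statements; closes nothing by itself (`--supports`).
References: [SerreAbelianLadic1968] Ch. I §2.1 (finite ramification); [NeukirchSchmidtWingberg2008]
VIII §3 (`G_S`); [Greenberg2006] Thm. 3 p. 342; [KellerYin2024] §1.1 (`θ : G_K → 𝓞^×`).
-/

set_option autoImplicit false
set_option linter.dupNamespace false

noncomputable section

open scoped Classical
open NumberField IsDedekindDomain Field PowerSeries
open Literature.NumberTheory.EllipticCurves Literature.NumberTheory.GaloisRepresentations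
  Literature.NumberTheory.IwasawaTheory Literature.NumberTheory.IwasawaTheory.Greenberg2016
  Literature.NumberTheory.IwasawaTheory.Greenberg2006 Literature.NumberTheory.EllipticCurves.KellerYin2024

namespace Summit.BirchSwinnertonDyer.BirchSwinnertonDyer.Theorems.GreenbergFullAtSelmer

/-! ## §1. Glue G-d: `θ` of finite order is unramified outside a finite `S ⊇ S_p` -/

section Model

variable {K : Type} [Field K] [NumberField K] {p : ℕ} [Fact p.Prime]
  (θ : FramedGaloisRep K (padicCoeffIntegers (∅ : Set (PadicAlgCl p))) 1)

omit [NumberField K] in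
/-- `θ(σ) = 1 ↔ unitChar θ (σ) = 1`: a `1 × 1` invertible matrix is its entry, and
`unitChar θ (σ)` is that entry read in `ℤ_p`. [cite: KellerYin2024, §1.1 (arXiv:2402.12781v2 TeX L441–449)] -/
theorem unitChar_eq_one_iff (σ : absoluteGaloisGroup K) : unitChar θ σ = 1 ↔ θ σ = 1 := by
  constructor
  · intro h
    have h00 := padicIntEquiv_unitChar θ σ
    rw [h, Units.val_one, map_one] at h00
    refine Units.ext (Matrix.ext fun i j ↦ ?_)
    rw [Fin.fin_one_eq_zero i, Fin.fin_one_eq_zero j, ← h00]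
    simp
  · intro h
    have h00 := padicIntEquiv_unitChar θ σ
    rw [h] at h00
    simp only [Units.val_one, Matrix.one_apply_eq] at h00
    exact Units.ext ((padicIntEquivCoeffIntegersEmpty p).injective (by rw [h00, Units.val_one, map_one]))

omit [NumberField K] in
/-- The kernel of `θ` is the kernel of `unitChar θ`. [cite: KellerYin2024, §1.1] -/
theorem ker_eq_ker_unitChar :
    (θ.toMonoidHom.ker : Subgroup (absoluteGaloisGroup K)) = (unitChar θ).toMonoidHom.ker := by
  ext σ
  rw [MonoidHom.mem_ker, MonoidHom.mem_ker]
  exact (unitChar_eq_one_iff θ σ).symm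

/-- **Glue G-d — a character of finite order is unramified outside a finite `S ⊇ S_p`, in the form
`N_S ≤ ker (unitChar θ)`** (the hypothesis `h` of `characterRepUnramified S θ h`): the kernel of `θ`
is open (`θⁿ = 1`, finite image), so `θ` is unramified at all but finitely many places
(`FramedGaloisRep.eventually_isUnramifiedAt_of_isOpen_ker`); take `S = S_p ∪ Ram(θ)` and apply
`ramificationSubgroup_le_ker`. [cite: SerreAbelianLadic1968, Ch. I §2.1] [cite: NeukirchSchmidtWingberg2008, VIII §3] -/
theorem exists_finite_ramificationSubgroup_le_ker_unitChar {n : ℕ} (hn : 0 < n)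
    (hθ : ∀ σ : absoluteGaloisGroup K, θ σ ^ n = 1) :
    ∃ S : Set (HeightOneSpectrum (𝓞 K)), S.Finite ∧
      (∀ w : HeightOneSpectrum (𝓞 K), ((p : ℕ) : 𝓞 K) ∈ w.asIdeal → w ∈ S) ∧
      ramificationSubgroup K S ≤ (unitChar θ).toMonoidHom.ker := by
  have hker : IsOpen (((unitChar θ).toMonoidHom.ker : Subgroup (absoluteGaloisGroup K)) :
      Set (absoluteGaloisGroup K)) := isOpen_ker_unitChar_of_pow_eq_one θ hn hθ
  have hkerθ : IsOpen ((θ.toMonoidHom.ker : Subgroup (absoluteGaloisGroup K)) :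
      Set (absoluteGaloisGroup K)) := by
    rw [ker_eq_ker_unitChar θ]
    exact hker
  have hfin : {v : HeightOneSpectrum (𝓞 K) | ¬ θ.IsUnramifiedAt v}.Finite :=
    Filter.eventually_cofinite.mp (θ.eventually_isUnramifiedAt_of_isOpen_ker hkerθ)
  have hp0 : ((p : ℕ) : 𝓞 K) ≠ 0 := by exact_mod_cast (Fact.out : p.Prime).ne_zero
  have hSp : {v : HeightOneSpectrum (𝓞 K) | ((p : ℕ) : 𝓞 K) ∈ v.asIdeal}.Finite := by
    have h := Ideal.finite_factors (I := Ideal.span {((p : ℕ) : 𝓞 K)})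
      (by rwa [Ne, Ideal.zero_eq_bot, Ideal.span_singleton_eq_bot])
    exact h.subset fun v hv ↦ Ideal.dvd_span_singleton.2 hv
  refine ⟨{v | ((p : ℕ) : 𝓞 K) ∈ v.asIdeal} ∪ {v | ¬ θ.IsUnramifiedAt v}, hSp.union hfin,
    fun w hw ↦ Or.inl hw, ?_⟩
  refine ramificationSubgroup_le_ker (unitChar θ).toMonoidHom hker fun v hv 𝔓 h𝔓 σ hσ ↦ ?_
  have hunr : θ.IsUnramifiedAt v := by
    by_contra hc
    exact hv (Or.inr hc)
  exact (unitChar_eq_one_iff θ σ).mpr (hunr 𝔓 h𝔓 σ hσ)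

omit [NumberField K] in
/-- `ρ_θⁿ = 1` for the model `characterRepUnramified S θ h` when `θⁿ = 1`. [cite: KellerYin2024, §1.1] -/
theorem characterRepUnramified_pow_eq_one {S : Set (HeightOneSpectrum (𝓞 K))}
    (h : ramificationSubgroup K S ≤ (unitChar θ).toMonoidHom.ker) {n : ℕ}
    (hθ : ∀ σ : absoluteGaloisGroup K, θ σ ^ n = 1) (g : GaloisGroupUnramifiedOutside K S) :
    characterRepUnramified S θ h g ^ n = 1 := by
  obtain ⟨σ, rfl⟩ := QuotientGroup.mk_surjective g
  refine LinearMap.ext fun b ↦ ?_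
  rw [← map_pow, ← QuotientGroup.mk_pow, Module.End.one_apply]
  change characterRepUnramified S θ h (toUnramifiedQuot K S (σ ^ n)) b = b
  rw [characterRepUnramified_mk_apply, map_pow, unitChar_pow_eq_one θ hθ σ, Units.val_one, one_smul]

end Model

/-! ## §2. The registered bridge from the PURE Shapiro statement for the named model -/

/-- **`stub_shapiroBridge` ⇐ the PURE Shapiro statement for `(ℚ_p/ℤ_p(θ), ρ_θ)`.** The registered
stub quantifies existentially over corank-one scalar models, a ring automorphism `ι` of `Λ₂` and
the identification `e`; this theorem supplies the model — `A := QpModZp p` (discrete: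
`QpModZp.discreteTopology`; `ContinuousSMul ℤ_p`: `QpModZp.continuousSMul`), `e₀ := refl`,
`ρ₀ := characterRepUnramified S θ h` for the `S ⊇ S_p ∪ Ram θ` of §1 (`hscalar`, `ρ₀ⁿ = 1`),
`ι := id` (ORIENTATION: `…TwistDeformationShapiroCocycle.X_smul_crossedHom_apply_zero`), discrete
topologies on `ℤ_p⟦T⟧` and `Λ₂` — and leaves to the K-Sh worker exactly the Shapiro identification
`e` with `D.toDual (r • x) (e c) = D.toDual x (e (r • c))`. The hypothesis quantifies universally over
the Prop-valued topological instances (any admissible choice; the worker's argument is topology-free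
on `Λ₂`). [cite: Greenberg2006, Thm. 3 p. 342 ("as Λ-modules")] [cite: Greenberg2016Selmer, §4.3 p. 21 L19–25] -/
theorem shapiroBridge_of_pureShapiroBridge
    (hpure : ∀ (p : ℕ) [Fact p.Prime] (K : Type) [Field K] [NumberField K], 2 < p →
      IsImaginaryQuadratic K →
      ∀ (v vbar : HeightOneSpectrum (𝓞 K)),
        ((p : ℕ) : 𝓞 K) ∈ v.asIdeal → ((p : ℕ) : 𝓞 K) ∈ vbar.asIdeal → vbar ≠ v →
      ∀ (κ₁ κ₂ : ZpExtension K p) (γ₁ γ₂ : absoluteGaloisGroup K),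
        ZpExtension.IsTopGeneratorPair κ₁ κ₂ γ₁ γ₂ →
      ∀ (θ : FramedGaloisRep K (padicCoeffIntegers (∅ : Set (PadicAlgCl p))) 1) (n : ℕ),
        0 < n → ¬ p ∣ n → (∀ σ : absoluteGaloisGroup K, θ σ ^ n = 1) →
      ∀ (S : Set (HeightOneSpectrum (𝓞 K))), S.Finite →
      ∀ (hS : ∀ w : HeightOneSpectrum (𝓞 K), ((p : ℕ) : 𝓞 K) ∈ w.asIdeal → w ∈ S)
        (h : ramificationSubgroup K S ≤ (unitChar θ).toMonoidHom.ker)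
        [TopologicalSpace (PowerSeries ℤ_[p])] [TopologicalSpace (PowerSeries (PowerSeries ℤ_[p]))]
        [IsTopologicalRing (PowerSeries (PowerSeries ℤ_[p]))] [DiscreteTopology (QpModZp p)]
        [ContinuousSMul ℤ_[p] (QpModZp p)] [IsTopologicalAddGroup (IndModule₂ ℤ_[p] p (QpModZp p))]
        [ContinuousSMul (PowerSeries (PowerSeries ℤ_[p])) (IndModule₂ ℤ_[p] p (QpModZp p))]
        (D : DualData₂ κ₁ κ₂ (charModule (∅ : Set (PadicAlgCl p)) θ) vbar γ₁ γ₂),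
      ∃ e : (fullAtSpecification S (twistDeformation S hS κ₁ κ₂ (characterRepUnramified S θ h))
          (Sum.inr v)).selmer ≃+ unrSelmer₂ κ₁ κ₂ (charModule (∅ : Set (PadicAlgCl p)) θ) vbar,
        ∀ (r : IwasawaAlgebra₂ p) (x : D.X)
          (c : (fullAtSpecification S (twistDeformation S hS κ₁ κ₂ (characterRepUnramified S θ h))
            (Sum.inr v)).selmer),
          D.toDual (r • x) (e c) = D.toDual x (e (r • c))) :
    ∀ (p : ℕ) [Fact p.Prime] (K : Type) [Field K] [NumberField K], 2 < p →
      IsImaginaryQuadratic K →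
      ∀ (v vbar : HeightOneSpectrum (𝓞 K)),
        ((p : ℕ) : 𝓞 K) ∈ v.asIdeal → ((p : ℕ) : 𝓞 K) ∈ vbar.asIdeal → vbar ≠ v →
      ∀ (κ₁ κ₂ : ZpExtension K p) (γ₁ γ₂ : absoluteGaloisGroup K),
        ZpExtension.IsTopGeneratorPair κ₁ κ₂ γ₁ γ₂ →
      ∀ (θ : FramedGaloisRep K (padicCoeffIntegers (∅ : Set (PadicAlgCl p))) 1) (n : ℕ),
        0 < n → ¬ p ∣ n → (∀ σ : absoluteGaloisGroup K, θ σ ^ n = 1) →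
      ∀ (D : DualData₂ κ₁ κ₂ (charModule (∅ : Set (PadicAlgCl p)) θ) vbar γ₁ γ₂),
      ∃ (S : Set (HeightOneSpectrum (𝓞 K))) (_ : S.Finite)
        (hS : ∀ w : HeightOneSpectrum (𝓞 K), ((p : ℕ) : 𝓞 K) ∈ w.asIdeal → w ∈ S)
        (A : Type) (_ : AddCommGroup A) (_ : Module ℤ_[p] A) (_ : TopologicalSpace A)
        (_ : DiscreteTopology A) (_ : ContinuousSMul ℤ_[p] A)
        (_ : TopologicalSpace (PowerSeries ℤ_[p])) (_ : TopologicalSpace (PowerSeries (PowerSeries ℤ_[p])))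
        (_ : IsTopologicalRing (PowerSeries (PowerSeries ℤ_[p])))
        (_ : IsTopologicalAddGroup (IndModule₂ ℤ_[p] p A))
        (_ : ContinuousSMul (PowerSeries (PowerSeries ℤ_[p])) (IndModule₂ ℤ_[p] p A))
        (_ : A ≃ₗ[ℤ_[p]] QpModZp p) (ρ₀ : ContinuousRep (GaloisGroupUnramifiedOutside K S) ℤ_[p] A)
        (_ : ∀ g : GaloisGroupUnramifiedOutside K S, ∃ t : ℤ_[p]ˣ, ∀ a : A, ρ₀ g a = (t : ℤ_[p]) • a)
        (_ : ∀ g : GaloisGroupUnramifiedOutside K S, ρ₀ g ^ n = 1)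
        (ι : IwasawaAlgebra₂ p ≃+* IwasawaAlgebra₂ p)
        (e : (fullAtSpecification S (twistDeformation S hS κ₁ κ₂ ρ₀) (Sum.inr v)).selmer ≃+
          unrSelmer₂ κ₁ κ₂ (charModule (∅ : Set (PadicAlgCl p)) θ) vbar),
        ∀ (r : IwasawaAlgebra₂ p) (x : D.X)
          (c : (fullAtSpecification S (twistDeformation S hS κ₁ κ₂ ρ₀) (Sum.inr v)).selmer),
          D.toDual (r • x) (e c) = D.toDual x (e (ι r • c)) := by
  intro p _ K _ _ hp hK v vbar hv hvbar hne κ₁ κ₂ γ₁ γ₂ hpair θ n hn hpn hθ D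
  obtain ⟨S, hSf, hS, h⟩ := exists_finite_ramificationSubgroup_le_ker_unitChar θ hn hθ
  -- the canonical (discrete) topological instances of the model
  letI tΛ₁ : TopologicalSpace (PowerSeries ℤ_[p]) := ⊥
  letI tΛ₂ : TopologicalSpace (PowerSeries (PowerSeries ℤ_[p])) := ⊥
  haveI : DiscreteTopology (PowerSeries (PowerSeries ℤ_[p])) := ⟨rfl⟩
  haveI hΛring : IsTopologicalRing (PowerSeries (PowerSeries ℤ_[p])) := inferInstance
  haveI hAdisc : DiscreteTopology (QpModZp p) := QpModZp.discreteTopology p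
  haveI hAsmul : ContinuousSMul ℤ_[p] (QpModZp p) := QpModZp.continuousSMul p
  haveI hDgrp : IsTopologicalAddGroup (IndModule₂ ℤ_[p] p (QpModZp p)) := inferInstance
  haveI hDsmul : ContinuousSMul (PowerSeries (PowerSeries ℤ_[p])) (IndModule₂ ℤ_[p] p (QpModZp p)) :=
    inferInstance
  obtain ⟨e, he⟩ := hpure p K hp hK v vbar hv hvbar hne κ₁ κ₂ γ₁ γ₂ hpair θ n hn hpn hθ S hSf hS h D
  exact ⟨S, hSf, hS, QpModZp p, inferInstance, inferInstance, inferInstance, hAdisc, hAsmul, tΛ₁, tΛ₂,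
    hΛring, hDgrp, hDsmul, LinearEquiv.refl ℤ_[p] (QpModZp p), characterRepUnramified S θ h,
    characterRepUnramified_hscalar S θ h, characterRepUnramified_pow_eq_one θ h hθ,
    RingEquiv.refl _, e, fun r x c ↦ he r x c⟩

end Summit.BirchSwinnertonDyer.BirchSwinnertonDyer.Theorems.GreenbergFullAtSelmer

end
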